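import Summits.KontsevichZagierPeriods.KontsevichZagierPeriods.Theorems.SoloInformedKZStokesCells
import HarnessLib

/-!
# SoloInformed — Green's formula on the standard triangle is a combination of KZ moves

Kontsevich–Zagier's rule (3) reads, in several variables, "replace the Newton–Leibniz formula by
Stokes's formula" [KZ 2001, §1.2]. The fixed calculus of `KZCalculus.lean` only has Newton–Leibniz
along the last coordinate of a band (`KZ.newtonLeibnizRel`). This file proves, inside that calculus
and without any further input, the first genuinely two-dimensional instance of Stokes:

**Theorem (`soloInformed_kzStokes_triangle`).** Let `W ⊆ ℝ²` be open, `Δ = {0 ≤ x, 0 ≤ y, x + y ≤ 1}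
⊆ W` the closed standard triangle, and `g₀ dx + g₁ dy` a `1`-form whose coefficients are
`ℚ`-semialgebraic and `C¹` on `W`. Then for ANY representations `rD = [Δ, ∂ₓg₁ − ∂_y g₀]`,
`rB = [[0,1], t ↦ g₀(t,0)]` (bottom edge), `rH = [[0,1], t ↦ (g₁ − g₀)(1−t,t)]` (hypotenuse) and
`rL = [[0,1], t ↦ g₁(0,t)]` (left edge, traversed downwards, hence the sign),
`[rD] − ([rB] + [rH] − [rL]) ∈ KZ.relations`;
such representations exist (`soloInformed_kzStokes_triangle_exists`).

The proof is the move-level Green formula: integrand additivity splits the curl; `∂_y g₀` is ONE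
Newton–Leibniz move on the band `Δ = {x ∈ [0,1], 0 ≤ y ≤ 1 − x}`; for `∂ₓ g₁` the coordinate swap
`(x,y) ↦ (y,x)` is a change-of-variables move with `|det| = 1`
(`soloInformed_of_sub_of_swap_mem_relations`)
followed by one Newton–Leibniz move; the edge terms are re-assembled by integrand additivity and the
reflection `t ↦ 1 − t` of `[0,1]`, again a change of variables with `|det| = 1`
(`soloInformed_of_sub_of_reflect_mem_relations`). Semialgebraicity of the partial derivatives is
Basu–Pollack–Roy Prop. 3.22 (`IsSemialgebraicFunOn.fderiv_apply_single`, tree). The cells, the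
representation constructors and the two `|det| = 1` moves live in `SoloInformedKZStokesCells.lean`.

Role (residency `solo-KontsevichZagierPeriods-informed`, PLAN.md THEOREM D / dictionary §3): this is
the case `m = 1` of the KZ–STOKES THEOREM — the only place where moves do work in the transfer map
from cohomological (Nori / Huber–Wüstholz) period relations to the naive calculus; the pull-back
form
(`Γ : Δ² → ℝ^M`, `η = Σ Q_j dy_j`, `g_i = Σ_j (Q_j ∘ Γ) ∂_iΓ_j`) is the literal instance
`g₀ dx + g₁ dy = Γ^*η` of the theorem. No claim beyond `m = 1` is made here.

References: M. Kontsevich, D. Zagier, *Periods* (2001), §1.2 rule (3); S. Basu, R. Pollack,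
M.-F. Roy, *Algorithms in Real Algebraic Geometry* (2006), Prop. 3.22; M. Spivak, *Calculus on
Manifolds* (1965), Thm. 4-13 (Stokes on chains; Green's theorem 5-5 ex.).
-/

noncomputable section

open MeasureTheory Set Filter
open scoped Topology

namespace Summit.KontsevichZagierPeriods.KontsevichZagierPeriods.Theorems

open Literature.NumberTheory.Transcendental Literature.NumberTheory.Transcendental.KZ
open Literature.ModelTheory.ExponentialFields (IsSemialgebraic)

/-! ### Green's formula on the triangle by moves -/

/-- **KZ–Stokes for `m = 1` (Green's formula on the standard triangle is a combination of moves).**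
See the module docstring. [Kontsevich–Zagier 2001, §1.2 rule (3)] -/
theorem soloInformed_kzStokes_triangle {W : Set (Fin 2 → ℝ)} (hW : IsOpen W)
    (hTW : soloInformedTriangle ⊆ W) {g₀ g₁ : (Fin 2 → ℝ) → ℝ}
    (hg₀s : IsSemialgebraicFunOn ℚ W g₀) (hg₁s : IsSemialgebraicFunOn ℚ W g₁)
    (hg₀d : ContDiffOn ℝ 1 g₀ W) (hg₁d : ContDiffOn ℝ 1 g₁ W)
    (rD : IntegralRep 2) (hDd : rD.domain = soloInformedTriangle)
    (hDi : EqOn rD.integrand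
      (fun z => fderiv ℝ g₁ z (Pi.single 0 1) - fderiv ℝ g₀ z (Pi.single 1 1)) soloInformedTriangle)
    (rB rH rL : IntegralRep 1) (hBd : rB.domain = soloInformedUnitI)
    (hHd : rH.domain = soloInformedUnitI) (hLd : rL.domain = soloInformedUnitI)
    (hBi : EqOn rB.integrand (fun x => g₀ ![x 0, 0]) soloInformedUnitI)
    (hHi : EqOn rH.integrand (fun x => g₁ ![1 - x 0, x 0] - g₀ ![1 - x 0, x 0]) soloInformedUnitI)
    (hLi : EqOn rL.integrand (fun x => g₁ ![0, x 0]) soloInformedUnitI) :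
    of rD - (of rB + of rH - of rL) ∈ relations := by
  have hTsa := isSemialgebraic_soloInformedTriangle
  have hIsa := isSemialgebraic_soloInformedUnitI
  have hsnoc : ∀ (x : Fin 1 → ℝ) (s : ℝ), (Fin.snoc x s : Fin 2 → ℝ) = ![x 0, s] :=
    fun x s => by ext i; fin_cases i <;> rfl
  -- calculus on `W`
  have hd₀ : ∀ z ∈ W, DifferentiableAt ℝ g₀ z := fun z hz =>
    (hg₀d.differentiableOn one_ne_zero z hz).differentiableAt (hW.mem_nhds hz)
  have hd₁ : ∀ z ∈ W, DifferentiableAt ℝ g₁ z := fun z hz =>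
    (hg₁d.differentiableOn one_ne_zero z hz).differentiableAt (hW.mem_nhds hz)
  have hc₀ : ContinuousOn g₀ W := hg₀d.continuousOn
  have hc₁ : ContinuousOn g₁ W := hg₁d.continuousOn
  -- the two partial derivatives, on the triangle
  have hAs : IsSemialgebraicFunOn ℚ soloInformedTriangle (fun z => fderiv ℝ g₁ z (Pi.single 0 1)) :=
    (hg₁s.fderiv_apply_single hW hd₁ 0).mono hTW hTsa
  have hBs : IsSemialgebraicFunOn ℚ soloInformedTriangle (fun z => fderiv ℝ g₀ z (Pi.single 1 1)) :=
    (hg₀s.fderiv_apply_single hW hd₀ 1).mono hTW hTsa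
  have hAc : ContinuousOn (fun z => fderiv ℝ g₁ z (Pi.single 0 1)) soloInformedTriangle :=
    ((hg₁d.continuousOn_fderiv_of_isOpen hW le_rfl).clm_apply continuousOn_const).mono hTW
  have hBc : ContinuousOn (fun z => fderiv ℝ g₀ z (Pi.single 1 1)) soloInformedTriangle :=
    ((hg₀d.continuousOn_fderiv_of_isOpen hW le_rfl).clm_apply continuousOn_const).mono hTW
  -- membership of fibre points
  have hsnocT : ∀ x : Fin 1 → ℝ, x ∈ soloInformedUnitI → ∀ t ∈ Icc (0 : ℝ) (1 - x 0),
      (Fin.snoc x t : Fin 2 → ℝ) ∈ soloInformedTriangle := fun x hx t ht => by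
    have hx' : 0 ≤ x 0 ∧ x 0 ≤ 1 := hx
    rw [hsnoc, soloInformed_vec2_mem_triangle]
    exact ⟨hx'.1, ht.1, by linarith [ht.2]⟩
  -- A = [Δ, ∂ₓ g₁],  Bn = [Δ, −∂_y g₀]
  let A : IntegralRep 2 := soloInformedTriRep (fun z => fderiv ℝ g₁ z (Pi.single 0 1)) hAs hAc
  let Bn : IntegralRep 2 :=
    soloInformedTriRep (fun z => -fderiv ℝ g₀ z (Pi.single 1 1)) hBs.neg hBc.neg
  have h1 : of rD - of A - of Bn ∈ relations :=
    integrandAddRel_subset_relations ⟨2, rD, A, Bn, by rw [hDd]; rfl, by rw [hDd]; rfl,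
      fun z hz => by
        rw [hDd] at hz
        rw [hDi hz]
        show fderiv ℝ g₁ z (Pi.single 0 1) - fderiv ℝ g₀ z (Pi.single 1 1) =
          fderiv ℝ g₁ z (Pi.single 0 1) + -fderiv ℝ g₀ z (Pi.single 1 1)
        ring, rfl⟩
  -- (i) Newton–Leibniz in `y` for `Bn`: base `Bb = [[0,1], −g₀(x,1−x) − (−g₀(x,0))]`
  obtain ⟨hEd_s, hEd_c⟩ := soloInformed_edge_comp hTW hg₀s hc₀
    ![MvPolynomial.X 0, 1 - MvPolynomial.X 0]
    (fun x => ![x 0, 1 - x 0]) (fun x => by ext j; fin_cases j <;> simp)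
    (fun x hx => by
      have hx' : 0 ≤ x 0 ∧ x 0 ≤ 1 := hx
      exact soloInformed_vec2_mem_triangle.2 ⟨hx'.1, by linarith, by linarith⟩)
  obtain ⟨hEb_s, hEb_c⟩ := soloInformed_edge_comp hTW hg₀s hc₀ ![MvPolynomial.X 0, 0]
    (fun x => ![x 0, 0]) (fun x => by ext j; fin_cases j <;> simp)
    (fun x hx => by
      have hx' : 0 ≤ x 0 ∧ x 0 ≤ 1 := hx
      exact soloInformed_vec2_mem_triangle.2 ⟨hx'.1, le_rfl, by linarith⟩)
  let Bb : IntegralRep 1 := soloInformedIRep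
    (fun x => -g₀ (Fin.snoc x (1 - x 0)) - -g₀ (Fin.snoc x 0))
    ((IsSemialgebraicFunOn.sub_holds hEd_s.neg hEb_s.neg).congr fun x _ => by
      simp only [Pi.sub_apply, Pi.neg_apply, hsnoc])
    ((hEd_c.neg.sub hEb_c.neg).congr fun x _ => by
      simp only [Pi.sub_apply, Pi.neg_apply, hsnoc])
  have h2 : of Bn - of Bb ∈ relations := by
    refine newtonLeibnizRel_subset_relations ⟨1, Bn, Bb, fun _ => 0, fun x => 1 - x 0,
      fun z => -g₀ z, (hg₀s.mono hTW hTsa).neg, ?_, ?_, ?_, soloInformedTriangle_eq_band,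
      ?_, ?_, fun _ _ => rfl, rfl⟩
    · show IsSemialgebraicFunOn ℚ soloInformedUnitI fun _ => (0 : ℝ)
      simpa using isSemialgebraicFunOn_ratCast hIsa 0
    · show IsSemialgebraicFunOn ℚ soloInformedUnitI fun x => 1 - x 0
      exact (IsSemialgebraicFunOn.sub_holds (isSemialgebraicFunOn_ratCast hIsa 1)
        (isSemialgebraicFunOn_apply hIsa 0)).congr fun x _ => by simp
    · intro x hx
      have hx' : 0 ≤ x 0 ∧ x 0 ≤ 1 := hx
      show (0 : ℝ) ≤ 1 - x 0
      linarith [hx'.2]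
    · intro x hx
      have hx' : x ∈ soloInformedUnitI := hx
      show ContinuousOn (fun t : ℝ => -g₀ (Fin.snoc x t)) (Icc 0 (1 - x 0))
      exact (hc₀.comp (soloInformed_continuous_snoc₂ x).continuousOn
        fun t ht => hTW (hsnocT x hx' t ht)).neg
    · intro x hx t ht
      have hx' : x ∈ soloInformedUnitI := hx
      have ht' : t ∈ Ioo (0 : ℝ) (1 - x 0) := ht
      have hzW : (Fin.snoc x t : Fin 2 → ℝ) ∈ W := hTW (hsnocT x hx' t (Ioo_subset_Icc_self ht'))
      show HasDerivAt (fun s : ℝ => -g₀ (Fin.snoc x s))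
        (-fderiv ℝ g₀ (Fin.snoc x t) (Pi.single 1 1)) t
      exact ((hd₀ _ hzW).hasFDerivAt.comp_hasDerivAt t (soloInformed_hasDerivAt_snoc₂ x t)).neg
  -- (ii) swap, then Newton–Leibniz in the (new) last coordinate for `A`
  have hA's : IsSemialgebraicFunOn ℚ soloInformedTriangle
      (fun y => fderiv ℝ g₁ (soloInformedSwap y) (Pi.single 0 1)) := by
    have := hAs.comp_equiv (Equiv.swap (0 : Fin 2) 1)
    rwa [soloInformed_setOf_swap_mem] at this
  have hA'c : ContinuousOn (fun y => fderiv ℝ g₁ (soloInformedSwap y) (Pi.single 0 1))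
      soloInformedTriangle :=
    hAc.comp continuous_soloInformedSwap.continuousOn fun z hz => soloInformedSwap_mem_iff.2 hz
  let A' : IntegralRep 2 :=
    soloInformedTriRep (fun y => fderiv ℝ g₁ (soloInformedSwap y) (Pi.single 0 1)) hA's hA'c
  have h3 : of A - of A' ∈ relations :=
    soloInformed_of_sub_of_swap_mem_relations A A' rfl rfl fun z _ => by
      show fderiv ℝ g₁ z (Pi.single 0 1) =
        fderiv ℝ g₁ (soloInformedSwap (soloInformedSwap z)) (Pi.single 0 1)
      rw [soloInformedSwap_soloInformedSwap]
  obtain ⟨hEh_s, hEh_c⟩ := soloInformed_edge_comp hTW hg₁s hc₁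
    ![1 - MvPolynomial.X 0, MvPolynomial.X 0]
    (fun x => ![1 - x 0, x 0]) (fun x => by ext j; fin_cases j <;> simp)
    (fun x hx => by
      have hx' : 0 ≤ x 0 ∧ x 0 ≤ 1 := hx
      exact soloInformed_vec2_mem_triangle.2 ⟨by linarith, hx'.1, by linarith⟩)
  obtain ⟨hEl_s, hEl_c⟩ := soloInformed_edge_comp hTW hg₁s hc₁ ![0, MvPolynomial.X 0]
    (fun x => ![0, x 0]) (fun x => by ext j; fin_cases j <;> simp)
    (fun x hx => by
      have hx' : 0 ≤ x 0 ∧ x 0 ≤ 1 := hx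
      exact soloInformed_vec2_mem_triangle.2 ⟨le_rfl, hx'.1, by linarith⟩)
  let Ab : IntegralRep 1 := soloInformedIRep
    (fun x => g₁ (soloInformedSwap (Fin.snoc x (1 - x 0))) - g₁ (soloInformedSwap (Fin.snoc x 0)))
    ((IsSemialgebraicFunOn.sub_holds hEh_s hEl_s).congr fun x _ => by
      simp only [Pi.sub_apply, soloInformedSwap_snoc₂])
    ((hEh_c.sub hEl_c).congr fun x _ => by simp only [Pi.sub_apply, soloInformedSwap_snoc₂])
  have h4 : of A' - of Ab ∈ relations := by
    refine newtonLeibnizRel_subset_relations ⟨1, A', Ab, fun _ => 0, fun x => 1 - x 0,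
      fun y => g₁ (soloInformedSwap y), ?_, ?_, ?_, ?_, soloInformedTriangle_eq_band,
      ?_, ?_, fun _ _ => rfl, rfl⟩
    · have := (hg₁s.mono hTW hTsa).comp_equiv (Equiv.swap (0 : Fin 2) 1)
      rwa [soloInformed_setOf_swap_mem] at this
    · show IsSemialgebraicFunOn ℚ soloInformedUnitI fun _ => (0 : ℝ)
      simpa using isSemialgebraicFunOn_ratCast hIsa 0
    · show IsSemialgebraicFunOn ℚ soloInformedUnitI fun x => 1 - x 0
      exact (IsSemialgebraicFunOn.sub_holds (isSemialgebraicFunOn_ratCast hIsa 1)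
        (isSemialgebraicFunOn_apply hIsa 0)).congr fun x _ => by simp
    · intro x hx
      have hx' : 0 ≤ x 0 ∧ x 0 ≤ 1 := hx
      show (0 : ℝ) ≤ 1 - x 0
      linarith [hx'.2]
    · intro x hx
      have hx' : x ∈ soloInformedUnitI := hx
      show ContinuousOn (fun t : ℝ => g₁ (soloInformedSwap (Fin.snoc x t))) (Icc 0 (1 - x 0))
      exact hc₁.comp
        (continuous_soloInformedSwap.comp (soloInformed_continuous_snoc₂ x)).continuousOn
        fun t ht => hTW (soloInformedSwap_mem_iff.2 (hsnocT x hx' t ht))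
    · intro x hx t ht
      have hx' : x ∈ soloInformedUnitI := hx
      have ht' : t ∈ Ioo (0 : ℝ) (1 - x 0) := ht
      have hzW : soloInformedSwap (Fin.snoc x t : Fin 2 → ℝ) ∈ W :=
        hTW (soloInformedSwap_mem_iff.2 (hsnocT x hx' t (Ioo_subset_Icc_self ht')))
      show HasDerivAt (fun s : ℝ => g₁ (soloInformedSwap (Fin.snoc x s)))
        (fderiv ℝ g₁ (soloInformedSwap (Fin.snoc x t)) (Pi.single 0 1)) t
      exact (hd₁ _ hzW).hasFDerivAt.comp_hasDerivAt t (soloInformed_hasDerivAt_swap_snoc₂ x t)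
  -- (iii) edge bookkeeping on `[0, 1]`
  let P₁ : IntegralRep 1 := soloInformedIRep (fun x => g₁ ![1 - x 0, x 0]) hEh_s hEh_c
  let N₁ : IntegralRep 1 := soloInformedIRep (fun x => -g₁ ![0, x 0]) hEl_s.neg hEl_c.neg
  let P₀ : IntegralRep 1 := soloInformedIRep (fun x => g₀ ![x 0, 0]) hEb_s hEb_c
  let N₀ : IntegralRep 1 := soloInformedIRep (fun x => -g₀ ![x 0, 1 - x 0]) hEd_s.neg hEd_c.neg
  obtain ⟨hEh₀_s, hEh₀_c⟩ := soloInformed_edge_comp hTW hg₀s hc₀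
    ![1 - MvPolynomial.X 0, MvPolynomial.X 0]
    (fun x => ![1 - x 0, x 0]) (fun x => by ext j; fin_cases j <;> simp)
    (fun x hx => by
      have hx' : 0 ≤ x 0 ∧ x 0 ≤ 1 := hx
      exact soloInformed_vec2_mem_triangle.2 ⟨by linarith, hx'.1, by linarith⟩)
  let N₀' : IntegralRep 1 := soloInformedIRep (fun x => -g₀ ![1 - x 0, x 0]) hEh₀_s.neg hEh₀_c.neg
  have h5 : of Ab - of P₁ - of N₁ ∈ relations :=
    integrandAddRel_subset_relations ⟨1, Ab, P₁, N₁, rfl, rfl, fun x _ => by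
      show g₁ (soloInformedSwap (Fin.snoc x (1 - x 0))) - g₁ (soloInformedSwap (Fin.snoc x 0)) =
        g₁ ![1 - x 0, x 0] + -g₁ ![0, x 0]
      rw [soloInformedSwap_snoc₂, soloInformedSwap_snoc₂]
      ring, rfl⟩
  have h6 : of Bb - of P₀ - of N₀ ∈ relations :=
    integrandAddRel_subset_relations ⟨1, Bb, P₀, N₀, rfl, rfl, fun x _ => by
      show -g₀ (Fin.snoc x (1 - x 0)) - -g₀ (Fin.snoc x 0) =
        g₀ ![x 0, 0] + -g₀ ![x 0, 1 - x 0]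
      rw [hsnoc, hsnoc]
      ring, rfl⟩
  have h7 : of N₀ - of N₀' ∈ relations :=
    soloInformed_of_sub_of_reflect_mem_relations N₀ N₀' rfl rfl fun x _ => by
      show -g₀ ![x 0, 1 - x 0] = -g₀ ![1 - (1 - x 0), 1 - x 0]
      rw [sub_sub_cancel]
  have h8 : of N₁ + of rL ∈ relations :=
    of_add_of_mem_relations_of_eqOn_neg (r := N₁) (r' := rL) (by rw [hLd]; rfl) fun x hx => by
      have hx' : x ∈ soloInformedUnitI := hx
      rw [hLi hx']
      show g₁ ![0, x 0] = -(-g₁ ![0, x 0])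
      rw [neg_neg]
  have h9 : of rH - of P₁ - of N₀' ∈ relations :=
    integrandAddRel_subset_relations ⟨1, rH, P₁, N₀', by rw [hHd]; rfl, by rw [hHd]; rfl,
      fun x hx => by
        rw [hHd] at hx
        rw [hHi hx]
        show g₁ ![1 - x 0, x 0] - g₀ ![1 - x 0, x 0] = g₁ ![1 - x 0, x 0] + -g₀ ![1 - x 0, x 0]
        ring, rfl⟩
  have h10 : of rB - of P₀ ∈ relations :=
    of_sub_of_mem_relations_of_eqOn (r := rB) (r' := P₀) (by rw [hBd]; rfl) fun x hx => by
      rw [hBd] at hx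
      exact hBi hx
  have key : of rD - (of rB + of rH - of rL) =
      (of rD - of A - of Bn) + (of Bn - of Bb) + (of A - of A') + (of A' - of Ab) +
        (of Ab - of P₁ - of N₁) + (of Bb - of P₀ - of N₀) + (of N₀ - of N₀') + (of N₁ + of rL) -
        (of rH - of P₁ - of N₀') - (of rB - of P₀) := by
    abel
  rw [key]
  exact relations.sub_mem (relations.sub_mem (relations.add_mem (relations.add_mem
    (relations.add_mem (relations.add_mem (relations.add_mem (relations.add_mem
    (relations.add_mem h1 h2) h3) h4) h5) h6) h7) h8) h9) h10

/-- **Green's formula on the triangle, as numbers**: `∫_Δ (∂ₓg₁ − ∂_y g₀) = ∫₀¹ g₀(t,0) dt +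
∫₀¹ (g₁ − g₀)(1−t,t) dt − ∫₀¹ g₁(0,t) dt`, obtained from `soloInformed_kzStokes_triangle` and the
soundness of the calculus (`KZ.relations_le_ker_eval_holds`) — i.e. from the one-variable
Newton–Leibniz formula and linear changes of variables only. -/
theorem soloInformed_green_triangle {W : Set (Fin 2 → ℝ)} (hW : IsOpen W)
    (hTW : soloInformedTriangle ⊆ W) {g₀ g₁ : (Fin 2 → ℝ) → ℝ}
    (hg₀s : IsSemialgebraicFunOn ℚ W g₀) (hg₁s : IsSemialgebraicFunOn ℚ W g₁)
    (hg₀d : ContDiffOn ℝ 1 g₀ W) (hg₁d : ContDiffOn ℝ 1 g₁ W)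
    (rD : IntegralRep 2) (hDd : rD.domain = soloInformedTriangle)
    (hDi : EqOn rD.integrand
      (fun z => fderiv ℝ g₁ z (Pi.single 0 1) - fderiv ℝ g₀ z (Pi.single 1 1)) soloInformedTriangle)
    (rB rH rL : IntegralRep 1) (hBd : rB.domain = soloInformedUnitI)
    (hHd : rH.domain = soloInformedUnitI) (hLd : rL.domain = soloInformedUnitI)
    (hBi : EqOn rB.integrand (fun x => g₀ ![x 0, 0]) soloInformedUnitI)
    (hHi : EqOn rH.integrand (fun x => g₁ ![1 - x 0, x 0] - g₀ ![1 - x 0, x 0]) soloInformedUnitI)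
    (hLi : EqOn rL.integrand (fun x => g₁ ![0, x 0]) soloInformedUnitI) :
    rD.value = rB.value + rH.value - rL.value := by
  have h := relations_le_ker_eval_holds (soloInformed_kzStokes_triangle hW hTW hg₀s hg₁s hg₀d hg₁d
    rD hDd hDi rB rH rL hBd hHd hLd hBi hHi hLi)
  rw [AddMonoidHom.mem_ker, map_sub, map_sub, map_add, eval_of, eval_of, eval_of, eval_of,
    sub_eq_zero] at h
  exact h

/-- **Existence of the four representations**, so that `soloInformed_kzStokes_triangle` is not
vacuous: Green's formula on the triangle, as a relation of the KZ calculus. -/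
theorem soloInformed_kzStokes_triangle_exists {W : Set (Fin 2 → ℝ)} (hW : IsOpen W)
    (hTW : soloInformedTriangle ⊆ W) {g₀ g₁ : (Fin 2 → ℝ) → ℝ}
    (hg₀s : IsSemialgebraicFunOn ℚ W g₀) (hg₁s : IsSemialgebraicFunOn ℚ W g₁)
    (hg₀d : ContDiffOn ℝ 1 g₀ W) (hg₁d : ContDiffOn ℝ 1 g₁ W) :
    ∃ (rD : IntegralRep 2) (rB rH rL : IntegralRep 1),
      rD.domain = soloInformedTriangle ∧
      (rD.integrand = fun z => fderiv ℝ g₁ z (Pi.single 0 1) - fderiv ℝ g₀ z (Pi.single 1 1)) ∧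
      rB.domain = soloInformedUnitI ∧ (rB.integrand = fun x => g₀ ![x 0, 0]) ∧
      rH.domain = soloInformedUnitI ∧
      (rH.integrand = fun x => g₁ ![1 - x 0, x 0] - g₀ ![1 - x 0, x 0]) ∧
      rL.domain = soloInformedUnitI ∧ (rL.integrand = fun x => g₁ ![0, x 0]) ∧
      of rD - (of rB + of rH - of rL) ∈ relations := by
  have hTsa := isSemialgebraic_soloInformedTriangle
  have hd₀ : ∀ z ∈ W, DifferentiableAt ℝ g₀ z := fun z hz =>
    (hg₀d.differentiableOn one_ne_zero z hz).differentiableAt (hW.mem_nhds hz)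
  have hd₁ : ∀ z ∈ W, DifferentiableAt ℝ g₁ z := fun z hz =>
    (hg₁d.differentiableOn one_ne_zero z hz).differentiableAt (hW.mem_nhds hz)
  have hAs : IsSemialgebraicFunOn ℚ soloInformedTriangle (fun z => fderiv ℝ g₁ z (Pi.single 0 1)) :=
    (hg₁s.fderiv_apply_single hW hd₁ 0).mono hTW hTsa
  have hBs : IsSemialgebraicFunOn ℚ soloInformedTriangle (fun z => fderiv ℝ g₀ z (Pi.single 1 1)) :=
    (hg₀s.fderiv_apply_single hW hd₀ 1).mono hTW hTsa
  have hAc : ContinuousOn (fun z => fderiv ℝ g₁ z (Pi.single 0 1)) soloInformedTriangle :=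
    ((hg₁d.continuousOn_fderiv_of_isOpen hW le_rfl).clm_apply continuousOn_const).mono hTW
  have hBc : ContinuousOn (fun z => fderiv ℝ g₀ z (Pi.single 1 1)) soloInformedTriangle :=
    ((hg₀d.continuousOn_fderiv_of_isOpen hW le_rfl).clm_apply continuousOn_const).mono hTW
  obtain ⟨hEb_s, hEb_c⟩ := soloInformed_edge_comp hTW hg₀s hg₀d.continuousOn ![MvPolynomial.X 0, 0]
    (fun x => ![x 0, 0]) (fun x => by ext j; fin_cases j <;> simp)
    (fun x hx => by
      have hx' : 0 ≤ x 0 ∧ x 0 ≤ 1 := hx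
      exact soloInformed_vec2_mem_triangle.2 ⟨hx'.1, le_rfl, by linarith⟩)
  obtain ⟨hEh_s, hEh_c⟩ := soloInformed_edge_comp hTW hg₁s hg₁d.continuousOn
    ![1 - MvPolynomial.X 0, MvPolynomial.X 0]
    (fun x => ![1 - x 0, x 0]) (fun x => by ext j; fin_cases j <;> simp)
    (fun x hx => by
      have hx' : 0 ≤ x 0 ∧ x 0 ≤ 1 := hx
      exact soloInformed_vec2_mem_triangle.2 ⟨by linarith, hx'.1, by linarith⟩)
  obtain ⟨hEh₀_s, hEh₀_c⟩ := soloInformed_edge_comp hTW hg₀s hg₀d.continuousOn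
    ![1 - MvPolynomial.X 0, MvPolynomial.X 0]
    (fun x => ![1 - x 0, x 0]) (fun x => by ext j; fin_cases j <;> simp)
    (fun x hx => by
      have hx' : 0 ≤ x 0 ∧ x 0 ≤ 1 := hx
      exact soloInformed_vec2_mem_triangle.2 ⟨by linarith, hx'.1, by linarith⟩)
  obtain ⟨hEl_s, hEl_c⟩ := soloInformed_edge_comp hTW hg₁s hg₁d.continuousOn ![0, MvPolynomial.X 0]
    (fun x => ![0, x 0]) (fun x => by ext j; fin_cases j <;> simp)
    (fun x hx => by
      have hx' : 0 ≤ x 0 ∧ x 0 ≤ 1 := hx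
      exact soloInformed_vec2_mem_triangle.2 ⟨le_rfl, hx'.1, by linarith⟩)
  refine ⟨soloInformedTriRep _ (IsSemialgebraicFunOn.sub_holds hAs hBs) (hAc.sub hBc),
    soloInformedIRep _ hEb_s hEb_c,
    soloInformedIRep _ (IsSemialgebraicFunOn.sub_holds hEh_s hEh₀_s) (hEh_c.sub hEh₀_c),
    soloInformedIRep _ hEl_s hEl_c, rfl, rfl, rfl, rfl, rfl, rfl, rfl, rfl, ?_⟩
  exact soloInformed_kzStokes_triangle hW hTW hg₀s hg₁s hg₀d hg₁d _ rfl (fun _ _ => rfl) _ _ _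
    rfl rfl rfl (fun _ _ => rfl) (fun _ _ => rfl) (fun _ _ => rfl)

end Summit.KontsevichZagierPeriods.KontsevichZagierPeriods.Theorems
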